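import Summits.QuantumFields.BalabanUV.T4Continuum.Support.DirichletMonotoneExamples
import Summits.QuantumFields.BalabanUV.T4Continuum.Support.DirichletSplitPieces

/-!
# T⁴ programme, spine node NE2 (U1a), sub-row Δ1 «NE2⁰-Dirichlet» — THE COMPLEMENT OF A SCATTERED FAMILY OF LOCALLY CO-MONOTONE
# OBSTACLES IS LOCALLY MONOTONE (one obstacle per vertex patch)

NE2 formalisation swarm `b2b-balaban-t4-ne2-formalise-*`, LEAF PROVER 09 (gen 10), a small geometric brick for the re-entrant front (journal
`HOME/CLAIMS.log` 2026-08-21 l.23790 / l.24724; memo `t4/T4-EST-NE2-D1-CORNER.md`).  leaf-08-g3's Besov route proves the scalar Dirichlet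
two-level injected law on every LOCALLY MONOTONE union of unit blocks (`DirichletMonotoneTwoLevel.injected_le_of_locallyMonotone`), and
`DirichletMonotoneExamples.locallyMonotone_compl_of_isCoordBox` puts the complement of ONE coordinate box in that class; this seat's
`RegionGramTwoLevelMonotone.hK_monotone` (p243206) consumes it.  This lineage's W1 theorems, however, cover the complement of a SCATTERED
FAMILY of boxes (`RegionGaugeScatteredBoxes.sliceCoercive_boxes`, gen 9, hypothesis `hsep` = pairwise disjoint one-block collars).  THIS FILE
closes the gap at the level of the monotonicity class, generically and with displayed hypotheses only:

 * **`locallyMonotone_compl_family`**: for any family of obstacles `B : ι → (Tor M → Prop)` whose complements are each locally monotone and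
   which is SCATTERED — every vertex patch meets at most one obstacle (`huniq`) — the complement of the union `fun b => ∀ i, ¬ B i b` is
   locally monotone (a patch meeting no obstacle is trivially downward-closed; a patch meeting `B_i` inherits `B_i`'s closedness, the other
   obstacles being invisible there);
 * **`locallyMonotone_compl_family_of_sep`**: `huniq` follows from the metric condition "two obstacle blocks at sup-distance `≤ 1` belong to
   the same obstacle" (`hsep`, the block-level form of gen 9's disjoint collars), since two blocks of one patch are at sup-distance `≤ 1`
   (`near_of_inPatch`);
 * **`locallyMonotone_compl_boxFamily_of_sep`**, **`locallyMonotone_compl_finsetBoxFamily_of_sep`**: in particular for scattered families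
   of coordinate boxes (`IsCoordBox`), indexed by a type or by a `Finset`.

HONEST FRAMING (T4-DAG p. 1).  [folklore] elementary combinatorics of block sets; no estimate; nothing about [B9]'s printed regions;
`hinjK` ∕ W3 off boxes OPEN; Δ1 NOT closed; NE2 (U1a) NOT proved; spine PROVED 0/9 unchanged; NOT infinite volume, NOT a mass gap, NOT
the Clay problem.  HONEST DEPENDENCY: continuum YM on T⁴ ⇐ BetaPertH ∧ nine spine estimates (0/9 proved); BetaPertH ⇐ (D1) ∧ (D4) ∧
CAP+tail; G-an2-4 gates asym, D1 and NE2/3/4.  No `sorry`.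
-/

noncomputable section

namespace Summit.QuantumFields.BalabanUV.T4Continuum.DirichletMonotoneScattered

open Literature.MathematicalPhysics.QuantumFieldTheory.Balaban1983to89.B5Prop11Plancherel (Tor unitVec)
open Summit.QuantumFields.BalabanUV.T4Continuum
open Summit.QuantumFields.BalabanUV.T4Continuum.DirichletMonotoneCutoff (InPatch DownClosed UpClosed LocallyMonotone)
open Summit.QuantumFields.BalabanUV.T4Continuum.DirichletMonotoneExamples (locallyMonotone_compl_of_isCoordBox)
open Summit.QuantumFields.BalabanUV.T4Continuum.DirichletSplitPieces (inPatch_sub_of_upper inPatch_add_of_lower)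
open Summit.QuantumFields.BalabanUV.Beta.GAN24.DirichletBoxTwoLevel (IsCoordBox)

variable {d : ℕ} (M : Fin d → ℕ) [hM : ∀ μ, NeZero (M μ)]

/-! ## §1 The generic statement: one obstacle per patch -/

omit hM in
/-- locally monotone is a property of the block SET: pointwise-equivalent predicates are interchangeable. [folklore] -/
theorem locallyMonotone_congr {S S' : Tor M → Prop} (h : ∀ b, S b ↔ S' b) (hS : LocallyMonotone M S) : LocallyMonotone M S' := by
  have e : S = S' := funext fun b => propext (h b)
  subst e
  exact hS

omit hM in
/-- **THE COMPLEMENT OF A SCATTERED FAMILY OF LOCALLY CO-MONOTONE OBSTACLES IS LOCALLY MONOTONE**: if every `T ∖ B_i` is locally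
monotone and every vertex patch meets at most one obstacle, then `T ∖ ⋃_i B_i` is locally monotone. [folklore] -/
theorem locallyMonotone_compl_family {ι : Type*} (B : ι → Tor M → Prop) (hmono : ∀ i, LocallyMonotone M (fun b => ¬ B i b))
    (huniq : ∀ (v : Tor M) (i j : ι) (b b' : Tor M), InPatch M v b → B i b → InPatch M v b' → B j b' → i = j) :
    LocallyMonotone M (fun b => ∀ i, ¬ B i b) := by
  intro v μ
  by_cases h : ∃ i b₀, InPatch M v b₀ ∧ B i b₀
  · obtain ⟨i, b₀, hb₀, hB₀⟩ := h
    rcases hmono i v μ with hD | hU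
    · -- downward-closed at `(v, μ)` for `T ∖ B_i` ⇒ for the complement of the union
      refine Or.inl fun b hb hvμ hSb j hj => ?_
      have hij : j = i := huniq v j i _ _ (inPatch_sub_of_upper M hb hvμ) hj hb₀ hB₀
      subst hij
      exact hD b hb hvμ (hSb j) hj
    · refine Or.inr fun b hb hvμ hSb j hj => ?_
      have hij : j = i := huniq v j i _ _ (inPatch_add_of_lower M hb hvμ) hj hb₀ hB₀
      subst hij
      exact hU b hb hvμ (hSb j) hj
  · -- no obstacle meets the patch: downward-closed vacuously
    exact Or.inl fun b hb hvμ _ j hj => h ⟨j, _, inPatch_sub_of_upper M hb hvμ, hj⟩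

/-! ## §2 The metric form: obstacle blocks at sup-distance `≤ 1` belong to one obstacle -/

omit hM in
/-- two blocks of one vertex patch are at sup-distance `≤ 1`, coordinatewise. [folklore] -/
theorem near_of_inPatch {v b b' : Tor M} (hb : InPatch M v b) (hb' : InPatch M v b') (μ : Fin d) :
    b' μ = b μ ∨ b' μ = b μ + 1 ∨ b' μ + 1 = b μ := by
  rcases hb μ with h | h <;> rcases hb' μ with h' | h'
  · left; exact add_right_cancel (h'.symm.trans h)
  · right; left; exact h'.symm.trans h
  · right; right; exact h'.symm.trans h
  · left; exact h'.symm.trans h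

omit hM in
/-- **THE METRIC FORM**: if any two obstacle blocks at sup-distance `≤ 1` belong to the same obstacle (`hsep`) and every `T ∖ B_i` is
locally monotone, then `T ∖ ⋃_i B_i` is locally monotone. [folklore] -/
theorem locallyMonotone_compl_family_of_sep {ι : Type*} (B : ι → Tor M → Prop) (hmono : ∀ i, LocallyMonotone M (fun b => ¬ B i b))
    (hsep : ∀ (i j : ι) (b b' : Tor M), B i b → B j b' → (∀ μ, b' μ = b μ ∨ b' μ = b μ + 1 ∨ b' μ + 1 = b μ) → i = j) :
    LocallyMonotone M (fun b => ∀ i, ¬ B i b) :=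
  locallyMonotone_compl_family M B hmono fun _ i j _ _ hb hB hb' hB' => hsep i j _ _ hB hB' (near_of_inPatch M hb hb')

/-! ## §3 Scattered families of coordinate boxes -/

/-- **THE COMPLEMENT OF A SCATTERED FAMILY OF COORDINATE BOXES IS LOCALLY MONOTONE** (each `B_i` an `IsCoordBox`; blocks of two
different boxes are at sup-distance `≥ 2`). [folklore] -/
theorem locallyMonotone_compl_boxFamily_of_sep {ι : Type*} (B : ι → Tor M → Prop) (hbox : ∀ i, IsCoordBox M (B i))
    (hsep : ∀ (i j : ι) (b b' : Tor M), B i b → B j b' → (∀ μ, b' μ = b μ ∨ b' μ = b μ + 1 ∨ b' μ + 1 = b μ) → i = j) :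
    LocallyMonotone M (fun b => ∀ i, ¬ B i b) :=
  locallyMonotone_compl_family_of_sep M B (fun i => locallyMonotone_compl_of_isCoordBox M (hbox i)) hsep

/-- **… indexed by a finite set** `T` (the form of `RegionGaugeScatteredBoxes.boxesBlocks = T.biUnion …`): the complement
`fun b => ∀ t ∈ T, ¬ B t b` of a scattered finite family of coordinate boxes is locally monotone. [folklore] -/
theorem locallyMonotone_compl_finsetBoxFamily_of_sep {α : Type*} (T : Finset α) (B : α → Tor M → Prop)
    (hbox : ∀ t ∈ T, IsCoordBox M (B t))
    (hsep : ∀ t ∈ T, ∀ t' ∈ T, ∀ (b b' : Tor M), B t b → B t' b' → (∀ μ, b' μ = b μ ∨ b' μ = b μ + 1 ∨ b' μ + 1 = b μ) → t = t') :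
    LocallyMonotone M (fun b => ∀ t ∈ T, ¬ B t b) := by
  have h := locallyMonotone_compl_boxFamily_of_sep M (fun i : {t // t ∈ T} => B i.1) (fun i => hbox i.1 i.2)
    fun i j b b' hB hB' hn => Subtype.ext (hsep i.1 i.2 j.1 j.2 b b' hB hB' hn)
  exact locallyMonotone_congr M (fun b => ⟨fun hb t ht => hb ⟨t, ht⟩, fun hb (i : {t // t ∈ T}) => hb i.1 i.2⟩) h

end Summit.QuantumFields.BalabanUV.T4Continuum.DirichletMonotoneScattered

end
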